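import Mathlib
import HarnessLib

/-!
# TwoNotchSterility — the DOOM CERTIFICATE of the permissive two-notch P-book (p = 1): after a t-hosted event a
vacuum-reachable state never again has mirror-balanced queues (STAGING; census-2 g27, METHODS (dd.103)/(dd.103a),
pen text `pub-nsfunc-census-2/exact/perm-B/sterile/STERILE-B.md` §2–§3)

search for candidate a priori estimates; no regularity claim

STAGING ONLY (for the prove seat to place — suggested target
`Summits/NavierStokesRegularity/FunctionalMining/NoGo/TwoNotchSterility.lean`, kind proof + defs — or discard; census-2 files
nothing in the tree itself).  `import Mathlib` only; no tree module is used.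

WHAT IS KERNEL-CHECKED HERE.  The arithmetic heart of THEOREM T (t-HOST TRANSIENCE) of the pen text: an ABSTRACT GAP-PAIR SYSTEM and
its inductive invariant.  A p = 1 P-book state is (pen text §1, machine-checked successor-for-successor against the engine of record in
test T4) a pair of queues `Q_A`, `Q_B*` over `{±t, ±u}` with twin t-letters ('walls'); between consecutive walls sit the u-words ('gaps'),
and only their LENGTHS are kept here: a state is the front gap pair `G₀ = (|G₀(A)|, |G₀(B*)|)` followed by the list
`[(T₁, G₁), …, (T_k, G_k)]` of walls with the gap pair behind each; a wall is `true` for a `−t` letter (a SOURCE of u-letters in `Q_A`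
and a SINK in `Q_B*`) and `false` for `+t` (source in `Q_B*`, sink in `Q_A`).  The six moves of the book become (`Step`):
* `pushU`  — M-birth of a u-pair: the back gap pair grows by `(1, 1)`;
* `pushT`  — M-birth of a t-pair: a new wall with the empty pair `(0, 0)` behind it;
* `popU`   — P-meal of a u-pair: the front pair shrinks by `(1, 1)`;
* `popT`   — P-meal of a t-pair: allowed only when the front pair is `(0, 0)`; removes the first wall;
* `ins i`  — a t⁻-birth hosted by wall `i`: the SOURCE components of the two adjacent pairs grow by 1;
* `del i`  — a t⁺-meal hosted by wall `i`: the SINK components of the two adjacent pairs shrink by 1 (they must be ≥ 1, `delOK`).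
The abstraction forgets the letters, so it ALLOWS MORE moves than the book (e.g. `popU` does not ask the two front letters to be equal);
every invariant of the abstract system is therefore an invariant of the book.

THE INVARIANT (`Inv`, 'mirror-balanced or doom-certified'): either every twin gap pair has equal components, or the FIRST unequal pair
(from the front) has a wall behind it whose SOURCE component is the larger one.  `Cert` is its second half alone ('doom certificate').
Checked below: `Inv` holds at the empty circle and is preserved by every move (`inv_step`, `inv_of_reaches`); every wall-hosted move
from an `Inv` state lands in `Cert` (`cert_insAt_of_inv`, `cert_delAt_of_inv`); `Cert` is preserved by every move (`cert_step`,
`cert_of_reaches`) and excludes mirror balance (`not_mirrorish_of_cert`).  Headline `no_return`: from the empty circle, after any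
t-hosted move, no sequence of moves ever reaches a mirror-balanced state again (in particular never the empty circle, never a mirror word).

WHAT IS NOT KERNEL-CHECKED (pen, STERILE-B.md): the dictionary book ↔ queues (§1; test T4), Lemma B 'a closed walk through twin-skeleton
states with a wall present pops walls' and hence 'doom-certified ⇒ on no closed walk' (§2), and the kinematic corollaries (§4).
Nothing here is about Navier–Stokes; it is a statement about the toy chord gas of the K-functional programme.
-/

namespace Summit.NavierStokesRegularity.FunctionalMining.TwoNotchSterility

/-- A twin gap pair abstracted to its two lengths: `.1` in the `Q_A` copy, `.2` in the `Q_B*` copy. -/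
abbrev Gap := ℕ × ℕ

/-- Source component of a gap pair adjacent to wall `w` (`true` = `−t`: source side is `Q_A`). -/
def src (w : Bool) (g : Gap) : ℕ := if w then g.1 else g.2
/-- Sink component of a gap pair adjacent to wall `w`. -/
def snk (w : Bool) (g : Gap) : ℕ := if w then g.2 else g.1
/-- A balanced (mirror-length) pair. -/
def bal (g : Gap) : Prop := g.1 = g.2

/-- Effect of an insertion at wall `w` on an adjacent pair: the source component grows by one. -/
def srcBump (w : Bool) (g : Gap) : Gap := if w then (g.1 + 1, g.2) else (g.1, g.2 + 1)
/-- Effect of a deletion at wall `w` on an adjacent pair: the sink component shrinks by one. -/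
def snkDrop (w : Bool) (g : Gap) : Gap := if w then (g.1, g.2 - 1) else (g.1 - 1, g.2)

/-- M-birth of a u-pair: `(1,1)` added to the BACK gap pair. -/
def pushU : Gap → List (Bool × Gap) → Gap × List (Bool × Gap)
  | g, [] => ((g.1 + 1, g.2 + 1), [])
  | g, (w, g') :: rest => (g, (w, (pushU g' rest).1) :: (pushU g' rest).2)

/-- M-birth of a t-pair: a new last wall `wn` with the empty pair behind it. -/
def pushT (wn : Bool) (g : Gap) (l : List (Bool × Gap)) : Gap × List (Bool × Gap) :=
  (g, l ++ [(wn, (0, 0))])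

/-- t⁻-birth hosted by wall number `i` (0-based: wall `i` is `T_{i+1}`): source components of the pairs before and behind it grow. -/
def insAt : ℕ → Gap → List (Bool × Gap) → Gap × List (Bool × Gap)
  | _, g, [] => (g, [])
  | 0, g, (w, g') :: rest => (srcBump w g, (w, srcBump w g') :: rest)
  | i + 1, g, (w, g') :: rest => (g, (w, (insAt i g' rest).1) :: (insAt i g' rest).2)

/-- t⁺-meal hosted by wall number `i`: sink components of the pairs before and behind it shrink. -/
def delAt : ℕ → Gap → List (Bool × Gap) → Gap × List (Bool × Gap)
  | _, g, [] => (g, [])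
  | 0, g, (w, g') :: rest => (snkDrop w g, (w, snkDrop w g') :: rest)
  | i + 1, g, (w, g') :: rest => (g, (w, (delAt i g' rest).1) :: (delAt i g' rest).2)

/-- Side condition of a t⁺-meal: both deleted letters exist (sink components ≥ 1), and the wall exists. -/
def delOK : ℕ → Gap → List (Bool × Gap) → Prop
  | _, _, [] => False
  | 0, g, (w, g') :: _ => 1 ≤ snk w g ∧ 1 ≤ snk w g'
  | i + 1, _, (_, g') :: rest => delOK i g' rest

/-- The six moves of the abstract gap-pair system. -/
inductive Step : Gap × List (Bool × Gap) → Gap × List (Bool × Gap) → Prop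
  | pushU (g : Gap) (l : List (Bool × Gap)) : Step (g, l) (pushU g l)
  | pushT (wn : Bool) (g : Gap) (l : List (Bool × Gap)) : Step (g, l) (pushT wn g l)
  | popU (a b : ℕ) (l : List (Bool × Gap)) : Step ((a + 1, b + 1), l) ((a, b), l)
  | popT (w : Bool) (g : Gap) (l : List (Bool × Gap)) : Step ((0, 0), (w, g) :: l) (g, l)
  | ins (i : ℕ) (g : Gap) (l : List (Bool × Gap)) (h : i < l.length) : Step (g, l) (insAt i g l)
  | del (i : ℕ) (g : Gap) (l : List (Bool × Gap)) (h : delOK i g l) : Step (g, l) (delAt i g l)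

/-- A wall-hosted (t-hosted) move. -/
inductive WallStep : Gap × List (Bool × Gap) → Gap × List (Bool × Gap) → Prop
  | ins (i : ℕ) (g : Gap) (l : List (Bool × Gap)) (h : i < l.length) : WallStep (g, l) (insAt i g l)
  | del (i : ℕ) (g : Gap) (l : List (Bool × Gap)) (h : delOK i g l) : WallStep (g, l) (delAt i g l)

/-- Invariant bookkeeping step (STERILE-B §2–§3; see the module docstring). [census-2; bookkeeping] -/ theorem WallStep.toStep {s s' : Gap × List (Bool × Gap)} (h : WallStep s s') : Step s s' := by
  cases h with
  | ins i g l h => exact Step.ins i g l h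
  | del i g l h => exact Step.del i g l h

/-- Reachability by any finite sequence of moves. -/
def Reaches : Gap × List (Bool × Gap) → Gap × List (Bool × Gap) → Prop := Relation.ReflTransGen Step

/-- The empty circle `[P M]`: no wall, empty front pair. -/
def vacuum : Gap × List (Bool × Gap) := ((0, 0), [])

/-- INVARIANT: mirror-balanced, or the first unbalanced pair is doom-certified (its back wall's source component is larger). -/
def Inv : Gap → List (Bool × Gap) → Prop
  | g, [] => bal g
  | g, (w, g') :: rest => (bal g ∧ Inv g' rest) ∨ snk w g < src w g

/-- DOOM CERTIFICATE: some pair is unbalanced and the first unbalanced pair has a back wall whose source component is larger. -/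
def Cert : Gap → List (Bool × Gap) → Prop
  | _, [] => False
  | g, (w, g') :: rest => (bal g ∧ Cert g' rest) ∨ snk w g < src w g

/-- Mirror balance: every twin gap pair has equal components (the length-shadow of a mirror word `Q_A = Q_B*`). -/
def Mirrorish : Gap → List (Bool × Gap) → Prop
  | g, [] => bal g
  | g, (_, g') :: rest => bal g ∧ Mirrorish g' rest

/-! ### small arithmetic facts about one pair -/

/-- Invariant bookkeeping step (STERILE-B §2–§3; see the module docstring). [census-2; bookkeeping] -/ theorem snk_lt_src_srcBump_of_bal (w : Bool) (g : Gap) (h : bal g) : snk w (srcBump w g) < src w (srcBump w g) := by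
  cases w <;> simp [snk, src, srcBump, bal] at * <;> omega

/-- Invariant bookkeeping step (STERILE-B §2–§3; see the module docstring). [census-2; bookkeeping] -/ theorem snk_lt_src_srcBump_of_lt (w : Bool) (g : Gap) (h : snk w g < src w g) :
    snk w (srcBump w g) < src w (srcBump w g) := by
  cases w <;> simp [snk, src, srcBump] at * <;> omega

/-- Invariant bookkeeping step (STERILE-B §2–§3; see the module docstring). [census-2; bookkeeping] -/ theorem snk_lt_src_snkDrop_of_bal (w : Bool) (g : Gap) (h : bal g) (h1 : 1 ≤ snk w g) :
    snk w (snkDrop w g) < src w (snkDrop w g) := by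
  cases w <;> simp [snk, src, snkDrop, bal] at * <;> omega

/-- Invariant bookkeeping step (STERILE-B §2–§3; see the module docstring). [census-2; bookkeeping] -/ theorem snk_lt_src_snkDrop_of_lt (w : Bool) (g : Gap) (h : snk w g < src w g) :
    snk w (snkDrop w g) < src w (snkDrop w g) := by
  cases w <;> simp [snk, src, snkDrop] at * <;> omega

/-- Invariant bookkeeping step (STERILE-B §2–§3; see the module docstring). [census-2; bookkeeping] -/ theorem not_bal_of_lt (w : Bool) (g : Gap) (h : snk w g < src w g) : ¬ bal g := by
  cases w <;> simp [snk, src, bal] at * <;> omega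

/-! ### the invariant is inductive -/

/-- Invariant bookkeeping step (STERILE-B §2–§3; see the module docstring). [census-2; bookkeeping] -/ theorem inv_vacuum : Inv vacuum.1 vacuum.2 := by
  simp [vacuum, Inv, bal]

/-- Invariant bookkeeping step (STERILE-B §2–§3; see the module docstring). [census-2; bookkeeping] -/ theorem inv_pushU : ∀ (l : List (Bool × Gap)) (g : Gap), Inv g l → Inv (pushU g l).1 (pushU g l).2
  | [], g, h => by
      simp [pushU, Inv, bal] at *; omega
  | (w, g') :: rest, g, h => by
      simp only [pushU, Inv] at *
      rcases h with ⟨hb, hr⟩ | hc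
      · exact Or.inl ⟨hb, inv_pushU rest g' hr⟩
      · exact Or.inr hc

/-- Invariant bookkeeping step (STERILE-B §2–§3; see the module docstring). [census-2; bookkeeping] -/ theorem inv_pushT (wn : Bool) : ∀ (l : List (Bool × Gap)) (g : Gap), Inv g l → Inv (pushT wn g l).1 (pushT wn g l).2
  | [], g, h => by
      simp only [pushT, List.nil_append, Inv] at *
      exact Or.inl ⟨h, by simp [bal]⟩
  | (w, g') :: rest, g, h => by
      have ih := inv_pushT wn rest g'
      simp only [pushT, Inv, List.cons_append] at *
      rcases h with ⟨hb, hr⟩ | hc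
      · exact Or.inl ⟨hb, ih hr⟩
      · exact Or.inr hc

/-- Invariant bookkeeping step (STERILE-B §2–§3; see the module docstring). [census-2; bookkeeping] -/ theorem inv_popU (a b : ℕ) : ∀ (l : List (Bool × Gap)), Inv (a + 1, b + 1) l → Inv (a, b) l
  | [], h => by
      simp [Inv, bal] at *; omega
  | (w, g') :: rest, h => by
      simp only [Inv] at *
      rcases h with ⟨hb, hr⟩ | hc
      · left; refine ⟨?_, hr⟩; simp [bal] at *; omega
      · right; cases w <;> simp [snk, src] at * <;> omega

/-- Invariant bookkeeping step (STERILE-B §2–§3; see the module docstring). [census-2; bookkeeping] -/ theorem inv_popT (w : Bool) (g : Gap) (l : List (Bool × Gap)) (h : Inv (0, 0) ((w, g) :: l)) : Inv g l := by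
  simp only [Inv] at h
  rcases h with ⟨_, hr⟩ | hc
  · exact hr
  · cases w <;> simp [snk, src] at hc

/-- Invariant bookkeeping step (STERILE-B §2–§3; see the module docstring). [census-2; bookkeeping] -/ theorem inv_insAt : ∀ (i : ℕ) (l : List (Bool × Gap)) (g : Gap), Inv g l → Inv (insAt i g l).1 (insAt i g l).2
  | i, [], g, h => by
      cases i <;> simpa [insAt, Inv] using h
  | 0, (w, g') :: rest, g, h => by
      simp only [insAt, Inv] at *
      rcases h with ⟨hb, _⟩ | hc
      · exact Or.inr (snk_lt_src_srcBump_of_bal w g hb)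
      · exact Or.inr (snk_lt_src_srcBump_of_lt w g hc)
  | i + 1, (w, g') :: rest, g, h => by
      simp only [insAt, Inv] at *
      rcases h with ⟨hb, hr⟩ | hc
      · exact Or.inl ⟨hb, inv_insAt i rest g' hr⟩
      · exact Or.inr hc

/-- Invariant bookkeeping step (STERILE-B §2–§3; see the module docstring). [census-2; bookkeeping] -/ theorem inv_delAt : ∀ (i : ℕ) (l : List (Bool × Gap)) (g : Gap), delOK i g l → Inv g l → Inv (delAt i g l).1 (delAt i g l).2
  | i, [], g, hok, h => by
      cases i <;> simp [delOK] at hok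
  | 0, (w, g') :: rest, g, hok, h => by
      simp only [delAt, Inv, delOK] at *
      rcases h with ⟨hb, _⟩ | hc
      · exact Or.inr (snk_lt_src_snkDrop_of_bal w g hb hok.1)
      · exact Or.inr (snk_lt_src_snkDrop_of_lt w g hc)
  | i + 1, (w, g') :: rest, g, hok, h => by
      simp only [delAt, Inv, delOK] at *
      rcases h with ⟨hb, hr⟩ | hc
      · exact Or.inl ⟨hb, inv_delAt i rest g' hok hr⟩
      · exact Or.inr hc

/-- `Inv` is preserved by every move. -/
theorem inv_step {s s' : Gap × List (Bool × Gap)} (hs : Step s s') (h : Inv s.1 s.2) : Inv s'.1 s'.2 := by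
  cases hs with
  | pushU g l => exact inv_pushU l g h
  | pushT wn g l => exact inv_pushT wn l g h
  | popU a b l => exact inv_popU a b l h
  | popT w g l => exact inv_popT w g l h
  | ins i g l hi => exact inv_insAt i l g h
  | del i g l hok => exact inv_delAt i l g hok h

/-- `Inv` holds in every state reachable from an `Inv` state, in particular from the empty circle. -/
theorem inv_of_reaches {s s' : Gap × List (Bool × Gap)} (hr : Reaches s s') (h : Inv s.1 s.2) : Inv s'.1 s'.2 := by
  induction hr with
  | refl => exact h
  | tail _ hst ih => exact inv_step hst ih

/-- Invariant bookkeeping step (STERILE-B §2–§3; see the module docstring). [census-2; bookkeeping] -/ theorem inv_of_reaches_vacuum {s : Gap × List (Bool × Gap)} (hr : Reaches vacuum s) : Inv s.1 s.2 :=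
  inv_of_reaches hr inv_vacuum

/-! ### the doom certificate is inductive, is created by every wall-hosted move, and excludes mirror balance -/

/-- Invariant bookkeeping step (STERILE-B §2–§3; see the module docstring). [census-2; bookkeeping] -/ theorem cert_pushU : ∀ (l : List (Bool × Gap)) (g : Gap), Cert g l → Cert (pushU g l).1 (pushU g l).2
  | [], g, h => by simp [Cert] at h
  | (w, g') :: rest, g, h => by
      simp only [pushU, Cert] at *
      rcases h with ⟨hb, hr⟩ | hc
      · exact Or.inl ⟨hb, cert_pushU rest g' hr⟩
      · exact Or.inr hc

/-- Invariant bookkeeping step (STERILE-B §2–§3; see the module docstring). [census-2; bookkeeping] -/ theorem cert_pushT (wn : Bool) : ∀ (l : List (Bool × Gap)) (g : Gap), Cert g l → Cert (pushT wn g l).1 (pushT wn g l).2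
  | [], g, h => by simp [Cert] at h
  | (w, g') :: rest, g, h => by
      have ih := cert_pushT wn rest g'
      simp only [pushT, Cert, List.cons_append] at *
      rcases h with ⟨hb, hr⟩ | hc
      · exact Or.inl ⟨hb, ih hr⟩
      · exact Or.inr hc

/-- Invariant bookkeeping step (STERILE-B §2–§3; see the module docstring). [census-2; bookkeeping] -/ theorem cert_popU (a b : ℕ) : ∀ (l : List (Bool × Gap)), Cert (a + 1, b + 1) l → Cert (a, b) l
  | [], h => by simp [Cert] at h
  | (w, g') :: rest, h => by
      simp only [Cert] at *
      rcases h with ⟨hb, hr⟩ | hc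
      · left; refine ⟨?_, hr⟩; simp [bal] at *; omega
      · right; cases w <;> simp [snk, src] at * <;> omega

/-- Invariant bookkeeping step (STERILE-B §2–§3; see the module docstring). [census-2; bookkeeping] -/ theorem cert_popT (w : Bool) (g : Gap) (l : List (Bool × Gap)) (h : Cert (0, 0) ((w, g) :: l)) : Cert g l := by
  simp only [Cert] at h
  rcases h with ⟨_, hr⟩ | hc
  · exact hr
  · cases w <;> simp [snk, src] at hc

/-- Invariant bookkeeping step (STERILE-B §2–§3; see the module docstring). [census-2; bookkeeping] -/ theorem cert_insAt : ∀ (i : ℕ) (l : List (Bool × Gap)) (g : Gap), Cert g l → Cert (insAt i g l).1 (insAt i g l).2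
  | i, [], g, h => by simp [Cert] at h
  | 0, (w, g') :: rest, g, h => by
      simp only [insAt, Cert] at *
      rcases h with ⟨hb, _⟩ | hc
      · exact Or.inr (snk_lt_src_srcBump_of_bal w g hb)
      · exact Or.inr (snk_lt_src_srcBump_of_lt w g hc)
  | i + 1, (w, g') :: rest, g, h => by
      simp only [insAt, Cert] at *
      rcases h with ⟨hb, hr⟩ | hc
      · exact Or.inl ⟨hb, cert_insAt i rest g' hr⟩
      · exact Or.inr hc

/-- Invariant bookkeeping step (STERILE-B §2–§3; see the module docstring). [census-2; bookkeeping] -/ theorem cert_delAt : ∀ (i : ℕ) (l : List (Bool × Gap)) (g : Gap), delOK i g l → Cert g l → Cert (delAt i g l).1 (delAt i g l).2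
  | i, [], g, hok, h => by simp [Cert] at h
  | 0, (w, g') :: rest, g, hok, h => by
      simp only [delAt, Cert, delOK] at *
      rcases h with ⟨hb, _⟩ | hc
      · exact Or.inr (snk_lt_src_snkDrop_of_bal w g hb hok.1)
      · exact Or.inr (snk_lt_src_snkDrop_of_lt w g hc)
  | i + 1, (w, g') :: rest, g, hok, h => by
      simp only [delAt, Cert, delOK] at *
      rcases h with ⟨hb, hr⟩ | hc
      · exact Or.inl ⟨hb, cert_delAt i rest g' hok hr⟩
      · exact Or.inr hc

/-- `Cert` is preserved by every move: doom is forever. -/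
theorem cert_step {s s' : Gap × List (Bool × Gap)} (hs : Step s s') (h : Cert s.1 s.2) : Cert s'.1 s'.2 := by
  cases hs with
  | pushU g l => exact cert_pushU l g h
  | pushT wn g l => exact cert_pushT wn l g h
  | popU a b l => exact cert_popU a b l h
  | popT w g l => exact cert_popT w g l h
  | ins i g l hi => exact cert_insAt i l g h
  | del i g l hok => exact cert_delAt i l g hok h

/-- Invariant bookkeeping step (STERILE-B §2–§3; see the module docstring). [census-2; bookkeeping] -/ theorem cert_of_reaches {s s' : Gap × List (Bool × Gap)} (hr : Reaches s s') (h : Cert s.1 s.2) : Cert s'.1 s'.2 := by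
  induction hr with
  | refl => exact h
  | tail _ hst ih => exact cert_step hst ih

/-- A wall-hosted insertion from an `Inv` state creates the certificate. -/
theorem cert_insAt_of_inv : ∀ (i : ℕ) (l : List (Bool × Gap)) (g : Gap), i < l.length → Inv g l →
    Cert (insAt i g l).1 (insAt i g l).2
  | i, [], g, hi, h => by simp at hi
  | 0, (w, g') :: rest, g, hi, h => by
      simp only [insAt, Inv, Cert] at *
      rcases h with ⟨hb, _⟩ | hc
      · exact Or.inr (snk_lt_src_srcBump_of_bal w g hb)
      · exact Or.inr (snk_lt_src_srcBump_of_lt w g hc)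
  | i + 1, (w, g') :: rest, g, hi, h => by
      simp only [insAt, Inv, Cert, List.length_cons] at *
      rcases h with ⟨hb, hr⟩ | hc
      · exact Or.inl ⟨hb, cert_insAt_of_inv i rest g' (by omega) hr⟩
      · exact Or.inr hc

/-- A wall-hosted deletion from an `Inv` state creates the certificate. -/
theorem cert_delAt_of_inv : ∀ (i : ℕ) (l : List (Bool × Gap)) (g : Gap), delOK i g l → Inv g l →
    Cert (delAt i g l).1 (delAt i g l).2
  | i, [], g, hok, h => by cases i <;> simp [delOK] at hok
  | 0, (w, g') :: rest, g, hok, h => by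
      simp only [delAt, Inv, Cert, delOK] at *
      rcases h with ⟨hb, _⟩ | hc
      · exact Or.inr (snk_lt_src_snkDrop_of_bal w g hb hok.1)
      · exact Or.inr (snk_lt_src_snkDrop_of_lt w g hc)
  | i + 1, (w, g') :: rest, g, hok, h => by
      simp only [delAt, Inv, Cert, delOK] at *
      rcases h with ⟨hb, hr⟩ | hc
      · exact Or.inl ⟨hb, cert_delAt_of_inv i rest g' hok hr⟩
      · exact Or.inr hc

/-- Invariant bookkeeping step (STERILE-B §2–§3; see the module docstring). [census-2; bookkeeping] -/ theorem cert_of_wallStep_of_inv {s s' : Gap × List (Bool × Gap)} (hw : WallStep s s') (h : Inv s.1 s.2) : Cert s'.1 s'.2 := by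
  cases hw with
  | ins i g l hi => exact cert_insAt_of_inv i l g hi h
  | del i g l hok => exact cert_delAt_of_inv i l g hok h

/-- A doom-certified state is not mirror-balanced. -/
theorem not_mirrorish_of_cert : ∀ (l : List (Bool × Gap)) (g : Gap), Cert g l → ¬ Mirrorish g l
  | [], g, h => by simp [Cert] at h
  | (w, g') :: rest, g, h => by
      simp only [Cert, Mirrorish] at *
      rcases h with ⟨_, hr⟩ | hc
      · intro hm; exact not_mirrorish_of_cert rest g' hr hm.2
      · intro hm; exact not_bal_of_lt w g hc hm.1

/-- Under `Inv`, a state is mirror-balanced or doom-certified (the dichotomy of the pen text). -/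
theorem mirrorish_or_cert_of_inv : ∀ (l : List (Bool × Gap)) (g : Gap), Inv g l → Mirrorish g l ∨ Cert g l
  | [], g, h => by left; simpa [Inv, Mirrorish] using h
  | (w, g') :: rest, g, h => by
      simp only [Inv, Mirrorish, Cert] at *
      rcases h with ⟨hb, hr⟩ | hc
      · rcases mirrorish_or_cert_of_inv rest g' hr with hm | hc'
        · exact Or.inl ⟨hb, hm⟩
        · exact Or.inr (Or.inl ⟨hb, hc'⟩)
      · exact Or.inr (Or.inr hc)

/-- The vacuum is mirror-balanced (so a doomed history never returns to it). -/
theorem mirrorish_vacuum : Mirrorish vacuum.1 vacuum.2 := by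
  simp [vacuum, Mirrorish, bal]

/-- **NO RETURN.**  From the empty circle: after any wall-hosted (t-hosted) move, no later state is mirror-balanced — in particular the
history never returns to the empty circle and never to (the length-shadow of) a mirror word. -/
theorem no_return {s s' s'' : Gap × List (Bool × Gap)} (h₀ : Reaches vacuum s) (hw : WallStep s s') (h₁ : Reaches s' s'') :
    ¬ Mirrorish s''.1 s''.2 :=
  not_mirrorish_of_cert s''.2 s''.1 (cert_of_reaches h₁ (cert_of_wallStep_of_inv hw (inv_of_reaches_vacuum h₀)))

/-- Invariant bookkeeping step (STERILE-B §2–§3; see the module docstring). [census-2; bookkeeping] -/ theorem no_return_to_vacuum {s s' : Gap × List (Bool × Gap)} (h₀ : Reaches vacuum s) (hw : WallStep s s') :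
    ¬ Reaches s' vacuum := fun h₁ =>
  no_return h₀ hw h₁ mirrorish_vacuum

/-- In a doom-certified state the first wall cannot be popped unless the certificate sits strictly behind it: if the front pair is
`(0,0)` the certificate passes to the tail (used in the pen proof: the certified wall itself is never poppable). -/
theorem cert_front_zero {w : Bool} {g : Gap} {l : List (Bool × Gap)} (h : Cert (0, 0) ((w, g) :: l)) : Cert g l :=
  cert_popT w g l h

/-- The certified pair is never `(0,0)`: a wall whose front pair carries the certificate is not poppable now. -/
theorem cert_head_not_poppable {w : Bool} {g : Gap} (hc : snk w g < src w g) : g ≠ (0, 0) := by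
  rintro rfl; cases w <;> simp [snk, src] at hc

/-! ### sanity instances (the non-example of the pen text and the smallest doomed history) -/

/-- The root `[P M u+ u−]` of the 12-event sector-0 t-hosted ORBIT class of the (8,12) table has queues `(∅, (u+,u−))`: front pair
`(0, 2)`, no wall — NOT `Inv` (unbalanced with no wall behind), hence not vacuum-reachable. -/
example : ¬ Inv (0, 2) [] := by simp [Inv, bal]

/-- Smallest doomed history: push a `−t` wall, insert at it: state `((1,0), [(true, (1,0))])` is certified. -/
example : Cert (insAt 0 (0, 0) [(true, (0, 0))]).1 (insAt 0 (0, 0) [(true, (0, 0))]).2 := by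
  simp [insAt, srcBump, Cert, snk, src]

example : Reaches vacuum ((0, 0), [(true, (0, 0))]) :=
  Relation.ReflTransGen.single (by simpa [vacuum, pushT] using Step.pushT true (0, 0) [])

end Summit.NavierStokesRegularity.FunctionalMining.TwoNotchSterility
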